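import Mathlib
import Summits.Ventures.PercRepro2.Defs
import Summits.Ventures.PercRepro2.Independence
import Summits.Ventures.PercRepro2.Harris
import Summits.Ventures.PercRepro2.Graph
import Summits.Ventures.PercRepro2.Events
import Summits.Ventures.PercRepro2.Induced
import Summits.Ventures.PercRepro2.Frontier
import Summits.Ventures.PercRepro2.CondAvoidPA
import Summits.Ventures.PercRepro2.MixedBoxDefs
import Summits.Ventures.PercRepro2.LSMPairRefutation
import Summits.Ventures.PercRepro2.BTVFamilyDefs
import Summits.Ventures.PercRepro2.BTVFamily

/-!
# (B-T): the log-supermodular pair `(NST, STN)` of the three-status law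
(blind cell PercRepro2, mine-1 g52; paper proofs/MINE1-BT.md §2.3)

`m(NST) · m(STN) ≤ m(SSN) · m(NTT)` on `{s ↮ t}` — the last open three-vertex class of the
LSM-pair family of `LSMPairTheorems.lean` / `LSMPairRefutation.lean` — is the singleton case
`A = {u}`, `W = {w}`, `U = univ` of the merged V-family `BTVFamily.vfamily`.  Two statements:
`lsm_NST_STN` in the `clusterInEvent`/`avoidAll` vocabulary of the nine provable pairs, and
`lsmPair_NST_STN : LSMPair (1, 2, 0) (2, 0, 1)` in the registry form (every finite graph, every
admissible rational weight vector, arbitrary roots and observed vertices).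
-/

namespace Summit.Ventures.PercRepro2

namespace BTVFamily

/-! ## (B-T) itself: the singleton case -/

section Corollary

variable {V : Type*} {E : Type*} [Fintype E] [DecidableEq E] [Fintype V] [DecidableEq V]
  {R : Type*} [CommRing R] [LinearOrder R] [IsStrictOrderedRing R]

omit [Fintype E] [DecidableEq E] [Fintype V] [DecidableEq V] in
/-- `{x} ↔ {y}` iff `x ↔ y`. -/
lemma connSet_singleton_singleton {ends : E → Sym2 V} {ω : Config E} {x y : V} :
    ConnSet ends ω {x} {y} ↔ Conn ends ω x y := by
  rw [connSet_singleton_left]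
  simp

omit [Fintype E] [DecidableEq E] [Fintype V] in
/-- `X ↔ Y₁ ∪ Y₂` iff `X ↔ Y₁` or `X ↔ Y₂`. -/
lemma connSet_union_right {ends : E → Sym2 V} {ω : Config E} {X Y₁ Y₂ : Finset V} :
    ConnSet ends ω X (Y₁ ∪ Y₂) ↔ ConnSet ends ω X Y₁ ∨ ConnSet ends ω X Y₂ := by
  constructor
  · rintro ⟨x, hx, y, hy, hxy⟩
    rcases Finset.mem_union.1 hy with hy | hy
    · exact Or.inl ⟨x, hx, y, hy, hxy⟩
    · exact Or.inr ⟨x, hx, y, hy, hxy⟩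
  · rintro (⟨x, hx, y, hy, hxy⟩ | ⟨x, hx, y, hy, hxy⟩)
    · exact ⟨x, hx, y, Finset.mem_union_left _ hy, hxy⟩
    · exact ⟨x, hx, y, Finset.mem_union_right _ hy, hxy⟩

omit [Fintype E] [DecidableEq E] [Fintype V] in
/-- `X₁ ∪ X₂ ↔ Y` iff `X₁ ↔ Y` or `X₂ ↔ Y`. -/
lemma connSet_union_left {ends : E → Sym2 V} {ω : Config E} {X₁ X₂ Y : Finset V} :
    ConnSet ends ω (X₁ ∪ X₂) Y ↔ ConnSet ends ω X₁ Y ∨ ConnSet ends ω X₂ Y := by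
  rw [connSet_comm, connSet_union_right, connSet_comm, connSet_comm (X := X₂)]

omit [Fintype E] [DecidableEq E] [Fintype V] in
/-- The cell `a` with singleton frontiers is `NST`: `v ∈ C_s`, `u ∉ C_s ∪ C_t`, `w ∈ C_t`,
`s ↮ t`. -/
lemma aProp_singleton_iff {ends : E → Sym2 V} {ω : Config E} {s t u v w : V} :
    aProp ends s t v {u} {w} ω ↔
      Conn ends ω s v ∧ ¬ Conn ends ω s u ∧ ¬ Conn ends ω t u ∧ Conn ends ω t w ∧
        ¬ Conn ends ω s t := by
  simp only [aProp, connSet_singleton_singleton, connSet_union_right, not_or]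
  constructor
  · rintro ⟨h1, h2, ⟨⟨h3, h4⟩, h5⟩, h6, h7⟩
    exact ⟨conn_symm h1, h4, h6, h2, h3⟩
  · rintro ⟨h1, h2, h3, h4, h5⟩
    exact ⟨conn_symm h1, h4, ⟨⟨h5, h2⟩, fun h => h5 (conn_trans h (conn_symm h4))⟩, h3,
      fun h => h3 (conn_trans h4 h)⟩

omit [Fintype E] [DecidableEq E] [Fintype V] in
/-- The cell `b` with singleton frontiers is `STN`. -/
lemma bProp_singleton_iff {ends : E → Sym2 V} {ω : Config E} {s t u v w : V} :
    bProp ends s t v {u} {w} ω ↔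
      Conn ends ω s u ∧ Conn ends ω t v ∧ ¬ Conn ends ω s w ∧ ¬ Conn ends ω t w ∧
        ¬ Conn ends ω s t := by
  simp only [bProp, connSet_singleton_singleton, connSet_union_right, not_or]
  constructor
  · rintro ⟨h1, h2, ⟨⟨h3, h4⟩, h5⟩, h6, h7⟩
    exact ⟨h2, conn_symm h1, h6, h5, fun h => h3 (conn_symm h)⟩
  · rintro ⟨h1, h2, h3, h4, h5⟩
    exact ⟨conn_symm h2, h1, ⟨⟨fun h => h5 (conn_symm h),
      fun h => h5 (conn_trans h1 (conn_symm h))⟩, h4⟩, h3, fun h => h3 (conn_trans h1 h)⟩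

omit [Fintype E] [DecidableEq E] [Fintype V] in
/-- The cell `j` with singleton frontiers is `SSN`. -/
lemma jProp_singleton_iff {ends : E → Sym2 V} {ω : Config E} {s t u v w : V} :
    jProp ends s t v {u} {w} ω ↔
      Conn ends ω s u ∧ Conn ends ω s v ∧ ¬ Conn ends ω s w ∧ ¬ Conn ends ω t w ∧
        ¬ Conn ends ω s t := by
  simp only [jProp, connSet_singleton_singleton, connSet_union_right, connSet_union_left, not_or]
  constructor
  · rintro ⟨h1, h2, ⟨⟨h3, h4⟩, h5⟩, h6, h7⟩
    refine ⟨h1, ?_, h6, h5, fun h => h3 (conn_symm h)⟩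
    rcases h2 with h2 | h2
    · exact conn_symm h2
    · exact conn_trans h1 (conn_symm h2)
  · rintro ⟨h1, h2, h3, h4, h5⟩
    exact ⟨h1, Or.inl (conn_symm h2), ⟨⟨fun h => h5 (conn_symm h),
      fun h => h5 (conn_trans h1 (conn_symm h))⟩, h4⟩, h3, fun h => h3 (conn_trans h1 h)⟩

omit [Fintype E] [DecidableEq E] [Fintype V] in
/-- The cell `m` with singleton frontiers is `NTT`. -/
lemma mProp_singleton_iff {ends : E → Sym2 V} {ω : Config E} {s t u v w : V} :
    mProp ends s t v {u} {w} ω ↔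
      ¬ Conn ends ω s u ∧ ¬ Conn ends ω t u ∧ Conn ends ω t v ∧ Conn ends ω t w ∧
        ¬ Conn ends ω s t := by
  simp only [mProp, connSet_singleton_singleton, connSet_union_right, connSet_union_left, not_or]
  constructor
  · rintro ⟨h1, h2, ⟨⟨h3, h4⟩, h5⟩, h6, h7⟩
    refine ⟨h4, h6, ?_, h1, h3⟩
    rcases h2 with h2 | h2
    · exact conn_symm h2
    · exact conn_trans h1 (conn_symm h2)
  · rintro ⟨h1, h2, h3, h4, h5⟩
    exact ⟨h4, Or.inl (conn_symm h3), ⟨⟨h5, h1⟩, fun h => h5 (conn_trans h (conn_symm h4))⟩, h2,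
      fun h => h2 (conn_trans h4 h)⟩

/-- **(B-T) = (LSM NST, STN)**, the last open three-vertex log-supermodular pair of the status
law, in the vocabulary of `LSMPairTheorems.lean` (explored root `s` on the left, the cells as
`{C_s ∈ 𝓤} ∩ {C_t ∈ 𝓥} ∩ {s ↮ X}`):
`P(v ∈ C_s, u ∉ C_s, w ∈ C_t, u ∉ C_t, s ↮ {u, w, t}) · P(u ∈ C_s, w ∉ C_s, v ∈ C_t, w ∉ C_t, s ↮ {v, w, t})
  ≤ P(u, v ∈ C_s, w ∉ C_s, w ∉ C_t, s ↮ {w, t}) · P(u ∉ C_s, v, w ∈ C_t, u ∉ C_t, s ↮ {u, v, w, t})`. -/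
theorem lsm_NST_STN (p : E → R) (hp : IsProbVec p) (ends : E → Sym2 V) (s t u v w : V) :
    prob p (clusterInEvent ends s {K | v ∈ K ∧ u ∉ K} ∩ clusterInEvent ends t {L | w ∈ L ∧ u ∉ L} ∩
        avoidAll ends s {u, w, t}) *
      prob p (clusterInEvent ends s {K | u ∈ K ∧ w ∉ K} ∩ clusterInEvent ends t {L | v ∈ L ∧ w ∉ L} ∩
        avoidAll ends s {v, w, t}) ≤
    prob p (clusterInEvent ends s {K | u ∈ K ∧ v ∈ K ∧ w ∉ K} ∩ clusterInEvent ends t {L | w ∉ L} ∩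
        avoidAll ends s {w, t}) *
      prob p (clusterInEvent ends s {K | u ∉ K} ∩ clusterInEvent ends t {L | v ∈ L ∧ w ∈ L ∧ u ∉ L} ∩
        avoidAll ends s {u, v, w, t}) := by
  have key := vfamily p hp ends s t v Finset.univ {u} {w} {u} {w} (Finset.subset_univ _)
    (Finset.subset_univ _) (Finset.subset_univ _) (Finset.subset_univ _)
  rw [Finset.union_self, Finset.inter_self, Finset.union_self, Finset.inter_self] at key
  have ea : aEv ends Finset.univ s t v {u} {w} =
      clusterInEvent ends s {K | v ∈ K ∧ u ∉ K} ∩ clusterInEvent ends t {L | w ∈ L ∧ u ∉ L} ∩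
        avoidAll ends s {u, w, t} := by
    ext ω
    simp only [aEv, Set.mem_setOf_eq, Finset.coe_univ, induced_univ, aProp_singleton_iff,
      Set.mem_inter_iff, mem_clusterInEvent, cluster, avoidAll, Finset.mem_insert,
      Finset.mem_singleton, forall_eq_or_imp, forall_eq]
    constructor
    · rintro ⟨h1, h2, h3, h4, h5⟩
      exact ⟨⟨⟨h1, h2⟩, h4, h3⟩, h2, fun h => h5 (conn_trans h (conn_symm h4)), h5⟩
    · rintro ⟨⟨⟨h1, h2⟩, h4, h3⟩, _, _, h5⟩
      exact ⟨h1, h2, h3, h4, h5⟩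
  have eb : bEv ends Finset.univ s t v {u} {w} =
      clusterInEvent ends s {K | u ∈ K ∧ w ∉ K} ∩ clusterInEvent ends t {L | v ∈ L ∧ w ∉ L} ∩
        avoidAll ends s {v, w, t} := by
    ext ω
    simp only [bEv, Set.mem_setOf_eq, Finset.coe_univ, induced_univ, bProp_singleton_iff,
      Set.mem_inter_iff, mem_clusterInEvent, cluster, avoidAll, Finset.mem_insert,
      Finset.mem_singleton, forall_eq_or_imp, forall_eq]
    constructor
    · rintro ⟨h1, h2, h3, h4, h5⟩
      exact ⟨⟨⟨h1, h3⟩, h2, h4⟩, fun h => h5 (conn_trans h (conn_symm h2)), h3, h5⟩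
    · rintro ⟨⟨⟨h1, h3⟩, h2, h4⟩, _, _, h5⟩
      exact ⟨h1, h2, h3, h4, h5⟩
  have ej : jEv ends Finset.univ s t v {u} {w} =
      clusterInEvent ends s {K | u ∈ K ∧ v ∈ K ∧ w ∉ K} ∩ clusterInEvent ends t {L | w ∉ L} ∩
        avoidAll ends s {w, t} := by
    ext ω
    simp only [jEv, Set.mem_setOf_eq, Finset.coe_univ, induced_univ, jProp_singleton_iff,
      Set.mem_inter_iff, mem_clusterInEvent, cluster, avoidAll, Finset.mem_insert,
      Finset.mem_singleton, forall_eq_or_imp, forall_eq]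
    constructor
    · rintro ⟨h1, h2, h3, h4, h5⟩
      exact ⟨⟨⟨h1, h2, h3⟩, h4⟩, h3, h5⟩
    · rintro ⟨⟨⟨h1, h2, h3⟩, h4⟩, _, h5⟩
      exact ⟨h1, h2, h3, h4, h5⟩
  have em : mEv ends Finset.univ s t v {u} {w} =
      clusterInEvent ends s {K | u ∉ K} ∩ clusterInEvent ends t {L | v ∈ L ∧ w ∈ L ∧ u ∉ L} ∩
        avoidAll ends s {u, v, w, t} := by
    ext ω
    simp only [mEv, Set.mem_setOf_eq, Finset.coe_univ, induced_univ, mProp_singleton_iff,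
      Set.mem_inter_iff, mem_clusterInEvent, cluster, avoidAll, Finset.mem_insert,
      Finset.mem_singleton, forall_eq_or_imp, forall_eq]
    constructor
    · rintro ⟨h1, h2, h3, h4, h5⟩
      exact ⟨⟨h1, h3, h4, h2⟩, h1, fun h => h5 (conn_trans h (conn_symm h3)),
        fun h => h5 (conn_trans h (conn_symm h4)), h5⟩
    · rintro ⟨⟨h1, h3, h4, h2⟩, _, _, _, h5⟩
      exact ⟨h1, h2, h3, h4, h5⟩
  rw [ea, eb, ej, em] at key
  exact key

end Corollary

/-! ## (B-T) as a log-supermodular pair of the cell's registry -/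

section LSMPairForm

open MixedBox

variable {V : Type*} {E : Type*} [Fintype E] [DecidableEq E] [Fintype V] [DecidableEq V]

omit [DecidableEq E] in
/-- `status = 2` iff `x ∈ C_s`. -/
lemma status_eq_two_iff (ends : E → Sym2 V) (s t x : V) (ω : Config E) :
    status ends s t x ω = 2 ↔ Conn ends ω s x := by
  unfold status
  split_ifs <;> simp_all

omit [DecidableEq E] in
/-- `status = 0` iff `x ∉ C_s` and `x ∈ C_t`. -/
lemma status_eq_zero_iff (ends : E → Sym2 V) (s t x : V) (ω : Config E) :
    status ends s t x ω = 0 ↔ ¬ Conn ends ω s x ∧ Conn ends ω t x := by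
  unfold status
  split_ifs <;> simp_all

omit [DecidableEq E] in
/-- `status = 1` iff `x ∉ C_s ∪ C_t`. -/
lemma status_eq_one_iff (ends : E → Sym2 V) (s t x : V) (ω : Config E) :
    status ends s t x ω = 1 ↔ ¬ Conn ends ω s x ∧ ¬ Conn ends ω t x := by
  unfold status
  split_ifs <;> simp_all

omit [DecidableEq E] in
/-- Membership in a single-cell event of the status grid on `{s ↮ t}`. -/
lemma mem_cell_iff (ends : E → Sym2 V) (s t u v w : V) (a b c : Fin 3) (ω : Config E) :
    ω ∈ gridEvent ends s t u v w {(a, b, c)} ∩ boxEvent ends s t u v w ∅ ∅ ↔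
      (status ends s t u ω = a ∧ status ends s t v ω = b ∧ status ends s t w ω = c) ∧
        ¬ Conn ends ω s t ∧ ¬ Conn ends ω t s := by
  simp only [gridEvent, boxEvent, CondAvoid.avoidEvent, Set.mem_inter_iff, Set.mem_setOf_eq,
    Finset.mem_singleton, Prod.mk.injEq, Finset.image_empty, Finset.empty_union, forall_eq]

/-- **(B-T) = (LSM NST, STN)** in the registry form of `LSMPairRefutation.lean`: the
log-supermodular pair inequality `m(NST) m(STN) ≤ m(SSN) m(NTT)` of the three-status law holds
for every finite graph, every admissible rational weight vector, roots `s, t` and observed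
vertices `u, v, w` (cells `(1,2,0)`, `(2,0,1)`; join `(2,2,1)`, meet `(1,0,0)` in the codes
`T = 0 < N = 1 < S = 2`). -/
theorem lsmPair_NST_STN : LSMPair (1, 2, 0) (2, 0, 1) := by
  intro V E _ _ _ _ p hp ends s t u v w
  show prob p (gridEvent ends s t u v w {(1, 2, 0)} ∩ boxEvent ends s t u v w ∅ ∅) *
      prob p (gridEvent ends s t u v w {(2, 0, 1)} ∩ boxEvent ends s t u v w ∅ ∅) ≤
    prob p (gridEvent ends s t u v w {cellJoin (1, 2, 0) (2, 0, 1)} ∩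
        boxEvent ends s t u v w ∅ ∅) *
      prob p (gridEvent ends s t u v w {cellMeet (1, 2, 0) (2, 0, 1)} ∩
        boxEvent ends s t u v w ∅ ∅)
  have hj : cellJoin (1, 2, 0) (2, 0, 1) = (2, 2, 1) := by decide
  have hm : cellMeet (1, 2, 0) (2, 0, 1) = (1, 0, 0) := by decide
  rw [hj, hm]
  have key := vfamily p hp ends s t v Finset.univ {u} {w} {u} {w} (Finset.subset_univ _)
    (Finset.subset_univ _) (Finset.subset_univ _) (Finset.subset_univ _)
  rw [Finset.union_self, Finset.inter_self, Finset.union_self, Finset.inter_self] at key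
  have ea : gridEvent ends s t u v w {(1, 2, 0)} ∩ boxEvent ends s t u v w ∅ ∅ =
      aEv ends Finset.univ s t v {u} {w} := by
    ext ω
    rw [mem_cell_iff]
    simp only [aEv, Set.mem_setOf_eq, Finset.coe_univ, induced_univ, aProp_singleton_iff,
      status_eq_one_iff, status_eq_two_iff, status_eq_zero_iff]
    constructor
    · rintro ⟨⟨⟨h1, h2⟩, h3, h4, h5⟩, h6, h7⟩
      exact ⟨h3, h1, h2, h5, h6⟩
    · rintro ⟨h3, h1, h2, h5, h6⟩
      exact ⟨⟨⟨h1, h2⟩, h3, fun h => h6 (conn_trans h (conn_symm h5)), h5⟩, h6,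
        fun h => h6 (conn_symm h)⟩
  have eb : gridEvent ends s t u v w {(2, 0, 1)} ∩ boxEvent ends s t u v w ∅ ∅ =
      bEv ends Finset.univ s t v {u} {w} := by
    ext ω
    rw [mem_cell_iff]
    simp only [bEv, Set.mem_setOf_eq, Finset.coe_univ, induced_univ, bProp_singleton_iff,
      status_eq_one_iff, status_eq_two_iff, status_eq_zero_iff]
    constructor
    · rintro ⟨⟨h1, ⟨h2, h3⟩, h4, h5⟩, h6, h7⟩
      exact ⟨h1, h3, h4, h5, h6⟩
    · rintro ⟨h1, h3, h4, h5, h6⟩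
      exact ⟨⟨h1, ⟨fun h => h6 (conn_trans h (conn_symm h3)), h3⟩, h4, h5⟩, h6,
        fun h => h6 (conn_symm h)⟩
  have ej : gridEvent ends s t u v w {(2, 2, 1)} ∩ boxEvent ends s t u v w ∅ ∅ =
      jEv ends Finset.univ s t v {u} {w} := by
    ext ω
    rw [mem_cell_iff]
    simp only [jEv, Set.mem_setOf_eq, Finset.coe_univ, induced_univ, jProp_singleton_iff,
      status_eq_one_iff, status_eq_two_iff]
    constructor
    · rintro ⟨⟨h1, h2, h3, h4⟩, h6, h7⟩
      exact ⟨h1, h2, h3, h4, h6⟩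
    · rintro ⟨h1, h2, h3, h4, h6⟩
      exact ⟨⟨h1, h2, h3, h4⟩, h6, fun h => h6 (conn_symm h)⟩
  have em : gridEvent ends s t u v w {(1, 0, 0)} ∩ boxEvent ends s t u v w ∅ ∅ =
      mEv ends Finset.univ s t v {u} {w} := by
    ext ω
    rw [mem_cell_iff]
    simp only [mEv, Set.mem_setOf_eq, Finset.coe_univ, induced_univ, mProp_singleton_iff,
      status_eq_one_iff, status_eq_zero_iff]
    constructor
    · rintro ⟨⟨⟨h1, h2⟩, ⟨h3, h4⟩, h5, h6⟩, h7, h8⟩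
      exact ⟨h1, h2, h4, h6, h7⟩
    · rintro ⟨h1, h2, h4, h6, h7⟩
      exact ⟨⟨⟨h1, h2⟩, ⟨fun h => h7 (conn_trans h (conn_symm h4)), h4⟩,
        ⟨fun h => h7 (conn_trans h (conn_symm h6)), h6⟩⟩, h7, fun h => h7 (conn_symm h)⟩
  rw [ea, eb, ej, em]
  exact key

end LSMPairForm

end BTVFamily

end Summit.Ventures.PercRepro2
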